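import Literature.Computability.QuantumComplexity.SlaterState
import HarnessLib

/-!
# Slater determinant states: restriction to a measured site (Slater ↦ Slater)

Trunk `Literature/Computability/QuantumComplexity`; API for `slaterState` (`SlaterState.lean`,
definition request `defn-slaterState`, route QuantumAdvantage/FermionicMagic) — all proved.
With `Fin.insertNth j b x` = the occupation pattern that is `x` on the `n` sites other than `j`
and `b` at site `j` (so that restriction lowers `n+1 ↦ n`, `k+1 ↦ k` by honest reindexing,
ready for inductions on the number of sites):

* `occupied_insertNth_false`, `occupied_insertNth_true` and the particle counts;
* `slaterState_insertNth_false` — conditioning site `j` EMPTY leaves the Slater determinant state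
  of the orbitals restricted to the other sites;
* `slaterState_insertNth_true` — conditioning site `j` OCCUPIED gives, by Laplace expansion along
  the column of `j`, `(-1)^{N_{<j}(x)} ∑ₐ (-1)^a φ a j · slaterState (φ minus row a)|_{other sites} x`,
  where `N_{<j}(x)` = number of occupied sites before `j` is the Jordan–Wigner string
  (`card_filter_succAbove_lt` identifies it with the column index of `j`);
* `slaterState_insertNth_true'` — the same with the string absorbed into the orbitals
  (`Z₀⋯Z_{j-1} = Γ(diag(±1))`, `slaterState_col_scale`): a combination of `k+1` Slater determinant
  states on the remaining `n` sites;
* `exists_slaterState_insertNth_true` — over a field, after row reduction, a SINGLE Slater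
  determinant: `slaterState φ (insertNth j true x) = c · slaterState ψ x` for all `x` ("Slater ↦
  Slater under an occupation-number measurement": the number-preserving case of the closure of
  fermionic Gaussian states under measuring `a†ⱼaⱼ`, used by restriction arguments for rank lower
  bounds).

Nearest-neighbour matchgates (two-mode rotations, fermionic swaps) are in
`SlaterStateMatchgate.lean`.

## References

* B. M. Terhal, D. P. DiVincenzo, *Classical simulation of noninteracting-fermion quantum
  circuits*, Phys. Rev. A 65 (2002) 032325, §3 (determinant amplitudes, anticommutation signs),
  §3.1 (measuring occupation numbers `a†ⱼaⱼ`, `aⱼa†ⱼ`). [TerhalDivincenzo2002]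
* F. R. Gantmacher, *The Theory of Matrices* I, Chelsea 1959, Ch. I §3 (Laplace expansion).

## Design choices

* Pure linear algebra over a commutative ring `R` (a field only for the single-determinant form,
  which divides by a pivot); Mathlib's `Matrix.det_succ_column` (Laplace) and
  `Matrix.det_eq_of_forall_row_eq_smul_add_const` (row reduction, via `slaterState_row_add_smul`).
-/

noncomputable section

open Matrix Finset

namespace Literature.Computability.QuantumComplexity

open Cryptography (QReg)

variable {R : Type*} [CommRing R] {n k : ℕ}

/-! ### Occupied sets of extended and modified patterns -/

/-- Inserting an empty site. [folklore] -/
theorem occupied_insertNth_false (j : Fin (n + 1)) (x : QReg n) :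
    occupied (j.insertNth false x) = (occupied x).map (Fin.succAboveEmb j) := by
  ext i
  rw [mem_occupied, mem_map]
  by_cases hij : i = j
  · subst hij
    rw [Fin.insertNth_apply_same]
    simp only [Bool.false_eq_true, false_iff, not_exists, not_and]
    exact fun i' _ => Fin.succAbove_ne i i'
  · obtain ⟨i', rfl⟩ := Fin.exists_succAbove_eq hij
    rw [Fin.insertNth_apply_succAbove]
    constructor
    · exact fun h => ⟨i', mem_occupied.2 h, rfl⟩
    · rintro ⟨i'', hi'', heq⟩
      rw [← Fin.succAbove_right_injective (p := j) heq]
      exact mem_occupied.1 hi''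

/-- Inserting an occupied site. [folklore] -/
theorem occupied_insertNth_true (j : Fin (n + 1)) (x : QReg n) :
    occupied (j.insertNth true x) = insert j ((occupied x).map (Fin.succAboveEmb j)) := by
  ext i
  rw [mem_occupied, mem_insert, mem_map]
  by_cases hij : i = j
  · subst hij
    rw [Fin.insertNth_apply_same]
    simp
  · obtain ⟨i', rfl⟩ := Fin.exists_succAbove_eq hij
    rw [Fin.insertNth_apply_succAbove]
    constructor
    · exact fun h => Or.inr ⟨i', mem_occupied.2 h, rfl⟩
    · rintro (h | ⟨i'', hi'', heq⟩)
      · exact absurd h (Fin.succAbove_ne j i')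
      · rw [← Fin.succAbove_right_injective (p := j) heq]
        exact mem_occupied.1 hi''

/-- The inserted site is not among the shifted old sites. [folklore] -/
theorem not_mem_map_succAboveEmb (j : Fin (n + 1)) (S : Finset (Fin n)) :
    j ∉ S.map (Fin.succAboveEmb j) := by
  rw [mem_map]
  rintro ⟨i, _, h⟩
  exact Fin.succAbove_ne j i h

/-- Particle number after inserting an empty site. [folklore] -/
theorem card_occupied_insertNth_false (j : Fin (n + 1)) (x : QReg n) :
    (occupied (j.insertNth false x)).card = (occupied x).card := by
  rw [occupied_insertNth_false, card_map]

/-- Particle number after inserting an occupied site. [folklore] -/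
theorem card_occupied_insertNth_true (j : Fin (n + 1)) (x : QReg n) :
    (occupied (j.insertNth true x)).card = (occupied x).card + 1 := by
  rw [occupied_insertNth_true, card_insert_of_notMem (not_mem_map_succAboveEmb j _), card_map]

/-! ### Restriction to a site (occupation-number measurement) -/

/-- **Empty site.** Conditioning site `j` to be empty leaves the Slater determinant state, on the
remaining `n` sites, of the orbitals restricted to those sites.
[Terhal–DiVincenzo 2002, §3.1 (measuring `aⱼa†ⱼ`)] [folklore] -/
theorem slaterState_insertNth_false (φ : Fin k → Fin (n + 1) → R) (j : Fin (n + 1)) (x : QReg n) :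
    slaterState φ (j.insertNth false x) = slaterState (fun a i => φ a (j.succAbove i)) x := by
  by_cases h : (occupied x).card = k
  · have h' : (occupied (j.insertNth false x)).card = k := by rw [card_occupied_insertNth_false, h]
    rw [slaterState_of_card_eq _ h', slaterState_of_card_eq _ h]
    have he : (fun b => j.succAbove ((occupied x).orderEmbOfFin h b)) =
        ⇑((occupied (j.insertNth false x)).orderEmbOfFin h') := by
      refine Finset.orderEmbOfFin_unique h' (fun b => ?_)
        ((Fin.strictMono_succAbove j).comp ((occupied x).orderEmbOfFin h).strictMono)
      rw [occupied_insertNth_false]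
      exact mem_map_of_mem (Fin.succAboveEmb j) (orderEmbOfFin_mem _ h b)
    rw [← he]
    rfl
  · have h' : (occupied (j.insertNth false x)).card ≠ k := by rwa [card_occupied_insertNth_false]
    rw [slaterState_of_card_ne _ h', slaterState_of_card_ne _ h]

/-- In the increasing enumeration of `occupied (j ↦ true, x)`, the columns other than that of `j`
are the shifted columns of `occupied x`, in order. [folklore] -/
theorem orderEmbOfFin_occupied_insertNth_true {j : Fin (n + 1)} {x : QReg n}
    (h : (occupied x).card = k) (h' : (occupied (j.insertNth true x)).card = k + 1)
    {p : Fin (k + 1)} (hp : (occupied (j.insertNth true x)).orderEmbOfFin h' p = j) (b : Fin k) :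
    (occupied (j.insertNth true x)).orderEmbOfFin h' (p.succAbove b) =
      j.succAbove ((occupied x).orderEmbOfFin h b) := by
  set e' := (occupied (j.insertNth true x)).orderEmbOfFin h'
  have hT : ((occupied x).map (Fin.succAboveEmb j)).card = k := by rw [card_map, h]
  have h1 : (fun b => e' (p.succAbove b)) = ⇑(((occupied x).map (Fin.succAboveEmb j)).orderEmbOfFin hT) := by
    refine orderEmbOfFin_unique hT (fun b => ?_) (e'.strictMono.comp (Fin.strictMono_succAbove p))
    have hmem : e' (p.succAbove b) ∈ occupied (j.insertNth true x) := orderEmbOfFin_mem _ _ _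
    rw [occupied_insertNth_true, mem_insert] at hmem
    rcases hmem with heq | hmem
    · exact absurd (e'.injective (heq.trans hp.symm)) (Fin.succAbove_ne p b)
    · exact hmem
  have h2 : (fun b => j.succAbove ((occupied x).orderEmbOfFin h b)) =
      ⇑(((occupied x).map (Fin.succAboveEmb j)).orderEmbOfFin hT) :=
    orderEmbOfFin_unique hT (fun b => mem_map_of_mem (Fin.succAboveEmb j) (orderEmbOfFin_mem _ h b))
      ((Fin.strictMono_succAbove j).comp ((occupied x).orderEmbOfFin h).strictMono)
  exact (congrFun h1 b).trans (congrFun h2 b).symm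

/-- The column index of the inserted occupied site `j` equals the number of occupied sites of `x`
that lie before `j` (the length of the Jordan–Wigner string). [folklore] -/
theorem card_filter_succAbove_lt {j : Fin (n + 1)} {x : QReg n}
    (h : (occupied x).card = k) (h' : (occupied (j.insertNth true x)).card = k + 1)
    {p : Fin (k + 1)} (hp : (occupied (j.insertNth true x)).orderEmbOfFin h' p = j) :
    ((occupied x).filter fun i => j.succAbove i < j).card = (p : ℕ) := by
  have hcols := orderEmbOfFin_occupied_insertNth_true h h' hp
  have step1 : ((occupied x).filter fun i => j.succAbove i < j).card =
      (univ.filter fun b : Fin k => j.succAbove ((occupied x).orderEmbOfFin h b) < j).card := by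
    conv_lhs => rw [← Finset.map_orderEmbOfFin_univ (occupied x) h]
    rw [Finset.filter_map, card_map]
    rfl
  have step2 : (univ.filter fun b : Fin k => j.succAbove ((occupied x).orderEmbOfFin h b) < j) =
      univ.filter fun b : Fin k => (b : ℕ) < p := by
    refine Finset.filter_congr fun b _ => ?_
    have key := ((occupied (j.insertNth true x)).orderEmbOfFin h').lt_iff_lt
      (a := p.succAbove b) (b := p)
    rw [hp, hcols b] at key
    rw [key, Fin.succAbove_lt_iff_castSucc_lt, Fin.lt_def]
    rfl
  rw [step1, step2, Fin.card_filter_val_lt, min_eq_right (Nat.lt_succ_iff.1 p.2)]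

/-- **Occupied site (Laplace expansion along the column of `j`).** Conditioning site `j` of a
`(k+1)`-orbital Slater determinant state to be occupied gives
`(-1)^{N_{<j}(x)} ∑ₐ (-1)^a φ a j · slaterState (φ without row a, restricted to the other sites) x`,
where `N_{<j}(x)` is the number of occupied sites of `x` before `j` (the Jordan–Wigner sign of
`a†ⱼ`). [Terhal–DiVincenzo 2002, §3 (anticommutation signs), §3.1] [folklore] -/
theorem slaterState_insertNth_true (φ : Fin (k + 1) → Fin (n + 1) → R) (j : Fin (n + 1)) (x : QReg n) :
    slaterState φ (j.insertNth true x) =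
      (-1) ^ ((occupied x).filter fun i => j.succAbove i < j).card *
        ∑ a : Fin (k + 1), (-1) ^ (a : ℕ) * φ a j *
          slaterState (fun a' i => φ (a.succAbove a') (j.succAbove i)) x := by
  by_cases h : (occupied x).card = k
  · have h' : (occupied (j.insertNth true x)).card = k + 1 := by rw [card_occupied_insertNth_true, h]
    obtain ⟨p, hp⟩ : j ∈ Set.range ((occupied (j.insertNth true x)).orderEmbOfFin h') := by
      rw [range_orderEmbOfFin, mem_coe, occupied_insertNth_true]
      exact mem_insert_self _ _
    have hcols := orderEmbOfFin_occupied_insertNth_true h h' hp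
    rw [slaterState_of_card_eq _ h', det_succ_column _ p, card_filter_succAbove_lt h h' hp,
      Finset.mul_sum]
    refine Finset.sum_congr rfl fun a _ => ?_
    rw [slaterState_of_card_eq _ h]
    have hsub : ((Matrix.of φ).submatrix id
        ((occupied (j.insertNth true x)).orderEmbOfFin h')).submatrix a.succAbove p.succAbove =
        (Matrix.of fun a' i => φ (a.succAbove a') (j.succAbove i)).submatrix id
          ((occupied x).orderEmbOfFin h) := by
      ext a' b
      simp only [submatrix_apply, id_eq, of_apply, hcols]
    rw [hsub, pow_add]
    simp only [submatrix_apply, id_eq, of_apply, hp]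
    ring
  · have h' : (occupied (j.insertNth true x)).card ≠ k + 1 := by
      rw [card_occupied_insertNth_true]; simpa using h
    rw [slaterState_of_card_ne _ h']
    symm
    refine mul_eq_zero_of_right _ (Finset.sum_eq_zero fun a _ => ?_)
    rw [slaterState_of_card_ne _ h, mul_zero]

/-- **Occupied site, Jordan–Wigner string absorbed.** As `slaterState_insertNth_true`, with the sign
`(-1)^{N_{<j}(x)}` absorbed into the orbitals by flipping their sign on the sites before `j`
(`Z₀⋯Z_{j-1} = Γ(diag(±1))`): the conditioned state is a combination of `k+1` Slater determinant
states on the remaining sites. [Terhal–DiVincenzo 2002, §3] [folklore] -/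
theorem slaterState_insertNth_true' (φ : Fin (k + 1) → Fin (n + 1) → R) (j : Fin (n + 1)) (x : QReg n) :
    slaterState φ (j.insertNth true x) =
      ∑ a : Fin (k + 1), (-1) ^ (a : ℕ) * φ a j *
        slaterState (fun a' i => (if j.succAbove i < j then -1 else 1) *
          φ (a.succAbove a') (j.succAbove i)) x := by
  rw [slaterState_insertNth_true, Finset.mul_sum]
  refine Finset.sum_congr rfl fun a _ => ?_
  rw [slaterState_col_scale, Finset.prod_ite, Finset.prod_const, Finset.prod_const_one, mul_one]
  ring

/-- **Slater ↦ Slater under an occupation-number measurement.** Over a field, conditioning a site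
of a `(k+1)`-orbital Slater determinant state on `n+1` sites to be occupied yields a scalar
multiple of a `k`-orbital Slater determinant state on the remaining `n` sites (row-reduce the
column of `j` to a single pivot, then Laplace). [Terhal–DiVincenzo 2002, §3.1; the
number-preserving case of the closure of Gaussian states under mode measurements] [folklore] -/
theorem exists_slaterState_insertNth_true {K : Type*} [Field K] (φ : Fin (k + 1) → Fin (n + 1) → K)
    (j : Fin (n + 1)) :
    ∃ (c : K) (ψ : Fin k → Fin n → K), ∀ x : QReg n,
      slaterState φ (j.insertNth true x) = c * slaterState ψ x := by
  by_cases hz : ∀ a, φ a j = 0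
  · refine ⟨0, fun _ _ => 0, fun x => ?_⟩
    rw [slaterState_insertNth_true', zero_mul]
    exact Finset.sum_eq_zero fun a _ => by rw [hz a, mul_zero, zero_mul]
  · push Not at hz
    obtain ⟨a₀, ha₀⟩ := hz
    -- clear the column of `j` by row operations with pivot row `a₀`
    obtain ⟨c, hc_def⟩ : ∃ c : Fin (k + 1) → K, c = fun a => if a = a₀ then 0 else -(φ a j / φ a₀ j) :=
      ⟨_, rfl⟩
    have hc : c a₀ = 0 := by rw [hc_def]; exact if_pos rfl
    have hcj : ∀ a, a ≠ a₀ → φ a j + c a * φ a₀ j = 0 := fun a ha => by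
      have : c a = -(φ a j / φ a₀ j) := by rw [hc_def]; exact if_neg ha
      rw [this, neg_mul, div_mul_cancel₀ _ ha₀, add_neg_cancel]
    refine ⟨(-1) ^ (a₀ : ℕ) * φ a₀ j, fun a' i => (if j.succAbove i < j then -1 else 1) *
      (φ (a₀.succAbove a') (j.succAbove i) + c (a₀.succAbove a') * φ a₀ (j.succAbove i)),
      fun x => ?_⟩
    rw [← slaterState_row_add_smul φ c a₀ hc, slaterState_insertNth_true', Finset.sum_eq_single a₀]
    · rw [hc, zero_mul, add_zero]
    · intro a _ ha
      rw [hcj a ha, mul_zero, zero_mul]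
    · intro ha₀
      exact absurd (mem_univ a₀) ha₀

end Literature.Computability.QuantumComplexity
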